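import Summits.QuantumFields.BalabanUV.Beta.BorderedHessianKernelAction
import Summits.QuantumFields.BalabanUV.Beta.BorderedHessianSymmetry
import Summits.QuantumFields.BalabanUV.Beta.AxialDressingRootedBmKernel

/-!
# BLINDNESS of the undressed bordered Hessian to the block-mean axial dressing: `bhK N ∘ Π̂_bm = bhK N = Π̂_bmᵀ ∘ bhK N`
# (β sub-cell, row BETA-an2, gen 13; the mechanism of X-an2-42 at operator level: `d*d` kills gradients, `𝒬_N Π_bm = 𝒬_N`)

HONEST FRAMING (cell charter, verbatim): «discharging BetaPertH makes Balaban's UV stability UNCONDITIONAL — a real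
constructive-QFT result; it is NOT the continuum limit and NOT the Clay problem.»  DERIVED cell leaf (pub-balaban β sub-cell, lane
an2 gen 13); no statement of Bałaban's papers is typed here, no `[cite:]` tag, no `Prop` fact; it instantiates no binder of the
β-function wall by itself.  NOT `BetaPertH`; NOT continuum; NOT Clay.

## What is here
In kernel conventions `trK (piKBm ρ N)` is the matrix of `Π̂_bm = Π_bm ⊕ 1` and `piKBm ρ N` that of its transpose, so that
`coDressKBmAt ρ N K = Π̂_bm K Π̂_bmᵀ` (`AxialDressingRootedBmKernel`).
* §1 the field column of `Π̂_bm` at `(inl β, z)` is `Π_bm δ_{(β,z)}` (`fcol_trK_piKBm_inl`, the window of `piKBm` being redundant by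
  `window_of_pmBm_ne_zero`), the other columns / rows; `curv (Π_bm A) = curv A` (`curv_axProjBmAt`);
* §2 **`comp_bhK_trK_piKBm : comp (bhK N) (trK (piKBm (toSite r) N)) = bhK N`** (RIGHT blindness: `curv ∘ grad = 0` for the field rows,
  `AxialProjectorBlockMean.contourSum_axProjBmAt` for the multiplier rows — the latter FAILS for the comb-root projector `Π_root`
  (`contourSum_axProjAt`), which is NOTE X-an2-42 again);
* §3 **`comp_piKBm_bhK : comp (piKBm (toSite r) N) (bhK N) = bhK N`** (LEFT blindness, by transposition through
  `BorderedHessianSymmetry.trK_bhK` and the sign-conjugation gadget).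

All declarations `[folklore]`; axioms standard.  Provenance: b2b-balaban β sub-cell, unit beta-an2 gen 13, 2026-08-20 (v1); over
`BorderedHessianKernel(Action)`, `BorderedHessianSymmetry`, `AxialDressingRootedBm(Kernel)`, `AxialProjectorBlockMean` BY NAME.
-/

open Finset
open scoped BigOperators
open Literature.Probability.LatticeModels (TorusSite Torus.proj Torus.proj_apply)
open Literature.MathematicalPhysics.QuantumFieldTheory
open Literature.MathematicalPhysics.QuantumFieldTheory.Balaban1983to89
open Literature.MathematicalPhysics.QuantumFieldTheory.Balaban1983to89.Beta
open B12Sec2to5 (l1 l1_nonneg)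
open ExpKernelCalculus (MKer Decays BiLoc comp tr shiftK)
open AffineAveraging (Form0 Form1 Form2 box toSite unitVec unitVec_apply dz curv curvAdj codiff₁ contourSum curv_dz)
open AffineReproduction (contourSumAdj curv_sub curvAdj_zero)
open LatticeForm (quo)
open KKTFluctuationKernel (delta1 delta1_apply)
open AveragingContours (grad grad_eq_dz)
open OneStepResolventKernel (Fib quo_zsmul eq_zsmul_quo_of_proj proj_zsmul)
open Summit.QuantumFields.BalabanUV.Beta.TameKernelCalculus
open Summit.QuantumFields.BalabanUV.Beta.AxialDressingRooted (cube mem_cube bondInd bondInd_apply pmBm piKBm piKBm_inl_inl piKBm_inl_inr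
  piKBm_inr_inl piKBm_inr_inr window_of_pmBm_ne_zero)
open Summit.QuantumFields.BalabanUV.Beta.AxialProjectorBlockMean (axProjBmAt contourSum_axProjBmAt)

namespace Summit.QuantumFields.BalabanUV.Beta.BorderedHessian

noncomputable section

variable {d : ℕ}

/-! ## §1 The columns of `Π̂_bm` and `curv ∘ Π_bm = curv` -/

section Columns

/-- [folklore] The real indicator of a bond is the cell's `delta1`. -/
theorem bondInd_cast_eq_delta1 (β : Fin (d + 1)) (z : Fin (d + 1) → ℤ) :
    (fun κ w => (bondInd β z κ w : ℝ)) = delta1 β z := by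
  funext κ w
  rw [bondInd_apply, delta1_apply]
  split_ifs <;> simp

/-- [folklore] The (windowed) matrix entry of `piKBm` IS the matrix of `Π_bm` (in-block root): `piKBm ρ N z y (inl β) (inl l) =
(Π_bm δ_{(β,z)})_l(y)`. -/
theorem piKBm_inl_inl_eq {N : ℕ} (hN : 1 ≤ N) {r : Fin (d + 1) → ℕ} (hr : r ∈ box (d + 1) N) (z y : Fin (d + 1) → ℤ)
    (β l : Fin (d + 1)) :
    piKBm (toSite r) N z y (Sum.inl β) (Sum.inl l) = axProjBmAt (toSite r) N (delta1 β z) l y := by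
  rw [piKBm_inl_inl, ← bondInd_cast_eq_delta1]
  split_ifs with h
  · rfl
  · by_contra hne
    exact h (window_of_pmBm_ne_zero hN hr (Ne.symm hne))

/-- [folklore] **THE FIELD COLUMN OF `Π̂_bm` AT `(inl β, z)` IS `Π_bm δ_{(β,z)}`.** -/
theorem fcol_trK_piKBm_inl {N : ℕ} (hN : 1 ≤ N) {r : Fin (d + 1) → ℕ} (hr : r ∈ box (d + 1) N) (z : Fin (d + 1) → ℤ)
    (β : Fin (d + 1)) : fcol (trK (piKBm (toSite r) N)) z (Sum.inl β) = axProjBmAt (toSite r) N (delta1 β z) := by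
  funext l y
  rw [fcol_apply, trK_apply, piKBm_inl_inl_eq hN hr]

/-- [folklore] The field column of `Π̂_bm` at a multiplier index vanishes. -/
theorem fcol_trK_piKBm_inr (ρ : Fin (d + 1) → ℤ) (N : ℕ) (z : Fin (d + 1) → ℤ) (β : Fin (d + 1)) :
    fcol (trK (piKBm ρ N)) z (Sum.inr β) = 0 := by
  funext l y
  rw [fcol_apply, trK_apply, piKBm_inr_inl]
  rfl

/-- [folklore] The multiplier column of `Π̂_bm` at a field index vanishes. -/
theorem mcol_trK_piKBm_inl (ρ : Fin (d + 1) → ℤ) (N : ℕ) (z : Fin (d + 1) → ℤ) (β : Fin (d + 1)) :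
    mcol N (trK (piKBm ρ N)) z (Sum.inl β) = 0 := by
  funext l y'
  rw [mcol_apply, trK_apply, piKBm_inl_inr]
  rfl

/-- [folklore] The multiplier column of `Π̂_bm` at `(inr β, z)`: for a coarse `z` it is the coarse indicator `δ_{(β, quo z)}`. -/
theorem mcol_trK_piKBm_inr_of_coarse {N : ℕ} [NeZero N] (ρ : Fin (d + 1) → ℤ) {z : Fin (d + 1) → ℤ} (hz : Torus.proj N z = 0)
    (β : Fin (d + 1)) : mcol N (trK (piKBm ρ N)) z (Sum.inr β) = delta1 β (quo N z) := by
  funext l y'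
  rw [mcol_apply, trK_apply, piKBm_inr_inr, delta1_apply]
  have hzq : z = (N : ℤ) • quo N z := eq_zsmul_quo_of_proj hz
  by_cases h : l = β ∧ y' = quo N z
  · obtain ⟨rfl, rfl⟩ := h
    rw [if_pos ⟨hzq, rfl⟩, if_pos ⟨rfl, rfl⟩]
  · rw [if_neg h, if_neg]
    rintro ⟨hzy, hβl⟩
    refine h ⟨hβl.symm, ?_⟩
    rw [hzy, quo_zsmul]

/-- [folklore] … and for a non-coarse `z` it vanishes. -/
theorem mcol_trK_piKBm_inr_of_not_coarse {N : ℕ} [NeZero N] (ρ : Fin (d + 1) → ℤ) {z : Fin (d + 1) → ℤ} (hz : Torus.proj N z ≠ 0)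
    (β : Fin (d + 1)) : mcol N (trK (piKBm ρ N)) z (Sum.inr β) = 0 := by
  funext l y'
  rw [mcol_apply, trK_apply, piKBm_inr_inr, if_neg]
  · rfl
  · rintro ⟨hzy, -⟩
    exact hz (by rw [hzy]; exact proj_zsmul y')

/-- [folklore] **`curv (Π_bm A) = curv A`**: the dressing is a gradient correction, killed by `curv` (`curv_dz`). -/
theorem curv_axProjBmAt (ρ : Fin (d + 1) → ℤ) (N : ℕ) (A : Form1 (d + 1) ℝ) : curv (axProjBmAt ρ N A) = curv A := by
  unfold AxialProjectorBlockMean.axProjBmAt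
  rw [curv_sub, grad_eq_dz, curv_dz, sub_zero]

/-- [folklore] `𝒬ᵀ_N 0 = 0`. -/
theorem contourSumAdj_zero (N : ℕ) : contourSumAdj N (0 : Form1 (d + 1) ℝ) = 0 := by
  funext κ x; simp [AffineReproduction.contourSumAdj]

/-- [folklore] `𝒬_N 0 = 0`. -/
theorem contourSum_zero (N : ℕ) : contourSum N (0 : Form1 (d + 1) ℝ) = 0 := by
  funext κ y; simp [AffineAveraging.contourSum]

/-- [folklore] `d*d 0 = 0`. -/
theorem curvAdj_curv_zero : curvAdj (curv (0 : Form1 (d + 1) ℝ)) = 0 := by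
  have h : curv (0 : Form1 (d + 1) ℝ) = 0 := by funext κ l x; simp [AffineAveraging.curv]
  rw [h, curvAdj_zero]

end Columns

/-! ## §2 Right blindness: `bhK N ∘ Π̂_bm = bhK N` -/

section Right

/-- [folklore] **RIGHT BLINDNESS OF THE BORDERED HESSIAN TO THE BLOCK-MEAN DRESSING**: `comp (bhK N) (trK (piKBm (toSite r) N)) = bhK N`
(in-block root, `N ≥ 1`). -/
theorem comp_bhK_trK_piKBm {N : ℕ} [NeZero N] {r : Fin (d + 1) → ℕ} (hr : r ∈ box (d + 1) N) :
    comp (bhK N) (trK (piKBm (toSite r) N)) = bhK (d := d) N := by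
  have hN : 1 ≤ N := Nat.one_le_iff_ne_zero.mpr (NeZero.ne N)
  funext x z a b
  rcases a with κ | κ <;> rcases b with β | β
  · rw [comp_bhK_inl, fcol_trK_piKBm_inl hN hr, mcol_trK_piKBm_inl, contourSumAdj_zero, curv_axProjBmAt, bhK_inl_inl_eq]
    simp
  · rw [comp_bhK_inl, fcol_trK_piKBm_inr, curvAdj_curv_zero, bhK_inl_inr]
    by_cases hz : Torus.proj N z = 0
    · rw [mcol_trK_piKBm_inr_of_coarse _ hz, if_pos hz]; simp
    · rw [mcol_trK_piKBm_inr_of_not_coarse _ hz, contourSumAdj_zero, if_neg hz]; simp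
  · rw [comp_bhK_inr, fcol_trK_piKBm_inl hN hr, contourSum_axProjBmAt _ hN, bhK_inr_inl]
  · rw [comp_bhK_inr, fcol_trK_piKBm_inr, contourSum_zero, bhK_inr_inr]
    split_ifs <;> rfl

end Right

/-! ## §3 Left blindness: `Π̂_bmᵀ ∘ bhK N = bhK N` by transposition -/

section Left

/-- [folklore] `piKBm` has vanishing mixed blocks, so `sgnK` fixes its transpose. -/
theorem sgnK_trK_piKBm (ρ : Fin (d + 1) → ℤ) (N : ℕ) : sgnK (trK (piKBm ρ N)) = trK (piKBm (d := d) ρ N) :=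
  sgnK_eq_self (fun x y κ l => by rw [trK_apply, piKBm_inr_inl]) (fun x y κ l => by rw [trK_apply, piKBm_inl_inr])

/-- [folklore] **LEFT BLINDNESS**: `comp (piKBm (toSite r) N) (bhK N) = bhK N` — transpose of the right blindness through
`trK (bhK N) = sgnK (bhK N)` and `S Π̂ S = Π̂`. -/
theorem comp_piKBm_bhK {N : ℕ} [NeZero N] {r : Fin (d + 1) → ℕ} (hr : r ∈ box (d + 1) N) :
    comp (piKBm (toSite r) N) (bhK N) = bhK (d := d) N := by
  have h : trK (comp (piKBm (toSite r) N) (bhK N)) = trK (bhK (d := d) N) := by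
    rw [trK_comp, trK_bhK, ← sgnK_trK_piKBm, comp_sgnK, comp_bhK_trK_piKBm hr]
  have h' := congrArg trK h
  rwa [trK_trK, trK_trK] at h'

end Left

end

end Summit.QuantumFields.BalabanUV.Beta.BorderedHessian
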